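import Summits.BirchSwinnertonDyer.BirchSwinnertonDyer.Theorems.KimAtThreeStubCartesianGap
import Summits.BirchSwinnertonDyer.Rank1Residual.GaloisImage.TorsionLevelDevissageHigher
import Summits.BirchSwinnertonDyer.Rank1Residual.GaloisImage.TorsionReductionOfLe
import HarnessLib

/-!
# Route `KimAtThreeKolyvagin` (rung W2), crux `StubAtEmptyLevelThree` (item 19561): Mazur–Rubin Lemma 4.1.1 (i)
# for `𝓕_can` — `H¹_{𝓕_can}(ℚ, E[3^{j+1}]) ≅ H¹_{𝓕_can}(ℚ, E[3^{k̃+1}])[3^{j+1}]` (the torsion identification (α)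
# behind the counts (iii) of the liftability road)

Cell `bsd-addord`, seat `bsd-addord-w2-c2` (gen 3). TOOL FILE: theorems only, no definition, no named fact, no
`sorry`; closes nothing; books nothing. HONEST FRAMING: BSD is not proved by any of this; item 19561 stays OPEN.

* `isSES_torsionInclusion_red_of_le` — `0 → E[3^j·3] →(incl) E[3^{k̃}·3] →(red) E[3^m·3] → 0` is a short exact
  sequence for ANY equivariant `red` acting as `3^{j+1}` on points, `m + (j+1) = k̃` (cell n1011's one-step
  `TorsionLevel.isSES_torsionInclusion_red` at an arbitrary gap).
* `exists_mem_selmerGroup_map_torsionInclusion_eq` — under surj(3): a class `y ∈ H¹_{𝓕_can}(ℚ, E[3^{k̃+1}])`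
  killed by `3^{j+1}` is `incl_* x` for a (unique) `x ∈ H¹_{𝓕_can}(ℚ, E[3^{j+1}])` (exactness + the general-gap
  cartesian property `KimAtThreeStubCartesianGap`).
* `natCard_torsion_selmerGroup_eq_of_lt` — **(α)** `#{y ∈ H¹_{𝓕_can}(ℚ, E[3^{k̃+1}]) : 3^{j+1}·y = 0} =
  #H¹_{𝓕_can}(ℚ, E[3^{j+1}])` for `j < k̃` (the counts `hcardj`, `hcardtop` of
  `KimAtThreeStubOfLiftable.stubShape_of_s24Deep` are `#H¹_{𝓕_can}(ℚ, E[3^{j+1}])` at `j = k̃−k−1`, `k̃−1`).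

References: [MazurRubin2004] Lemma 3.5.4, Lemma 4.1.1 (i) (p. 35); [MilneADT2006] I §6; [Sakamoto2024] Def. 3.5.
-/

-- the Theorems namespace of a single-conjunct summit repeats the summit name by design (D-0017)
set_option linter.dupNamespace false

noncomputable section

open scoped Classical NumberField ContRepresentation
open Function Field NumberField IsDedekindDomain WeierstrassCurve Literature.NumberTheory.EllipticCurves
  Literature.NumberTheory.GaloisRepresentations Literature.NumberTheory.GaloisRepresentations.DiscreteGaloisModule
  Literature.NumberTheory.GaloisCohomology
  Summit.BirchSwinnertonDyer.Rank1Residual.GaloisImage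

namespace Summit.BirchSwinnertonDyer.BirchSwinnertonDyer.Theorems.KimAtThreeStubOfLiftable

variable (W : WeierstrassCurve ℚ)

/-- **`0 → E[3^j·3] → E[3^{k̃}·3] → E[3^m·3] → 0` is short exact** (`m + (j+1) = k̃`, `red` = multiplication
by `3^{j+1}` on points; surjectivity = divisibility of `E(ℚ̄)`). [cite: MilneADT2006, Ch. I §6, proof of Prop. 6.9] -/
theorem isSES_torsionInclusion_red_of_le [W.IsElliptic] {j m kt : ℕ} (hm : m + (j + 1) = kt) (hjk : j ≤ kt)
    (red : (W.torsionGaloisModule (((3 : ℕ) : ℤ) ^ kt * ((3 : ℕ) : ℤ))).toContRepresentation →ⁱL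
      (W.torsionGaloisModule (((3 : ℕ) : ℤ) ^ m * ((3 : ℕ) : ℤ))).toContRepresentation)
    (hred : ∀ x : geomTorsion W (((3 : ℕ) : ℤ) ^ kt * ((3 : ℕ) : ℤ)),
      ((red x : geomTorsion W (((3 : ℕ) : ℤ) ^ m * ((3 : ℕ) : ℤ))) : geomPoints W) =
        (((3 : ℕ) : ℤ) ^ (j + 1)) • (x : geomPoints W)) :
    IsSES (DiscreteGaloisModule.homOfIntertwining (W.torsionInclusion (Transport.pow_mul_dvd_pow_mul hjk)))
      (DiscreteGaloisModule.homOfIntertwining red) where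
  comp_eq_zero := by
    ext P
    have h := (mem_geomTorsion_iff W _ _).mp P.2
    change ((red (W.torsionInclusion (Transport.pow_mul_dvd_pow_mul hjk) P) :
      geomTorsion W (((3 : ℕ) : ℤ) ^ m * ((3 : ℕ) : ℤ))) : geomPoints W) = 0
    rw [hred, coe_torsionInclusion_apply, pow_succ]
    exact h
  injective := fun P Q h => Subtype.ext (congrArg Subtype.val h :)
  exact_mid := fun P hP => by
    have hP' : (((3 : ℕ) : ℤ) ^ j * ((3 : ℕ) : ℤ)) • (P : geomPoints W) = 0 := by
      rw [← pow_succ, ← hred]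
      exact congrArg Subtype.val hP
    exact ⟨⟨P, (mem_geomTorsion_iff W _ _).mpr hP'⟩, rfl⟩
  surjective := fun Q => by
    have h3 : (((3 : ℕ) : ℤ) ^ (j + 1)) ≠ 0 := pow_ne_zero _ (by norm_num)
    obtain ⟨P, hP⟩ := W.zsmul_geomPoints_surjective_of_charZero h3 (Q : geomPoints W)
    have hP' : (((3 : ℕ) : ℤ) ^ (j + 1)) • P = (Q : geomPoints W) := hP
    have hPmem : P ∈ geomTorsion W (((3 : ℕ) : ℤ) ^ kt * ((3 : ℕ) : ℤ)) := by
      rw [mem_geomTorsion_iff]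
      have hsplit : ((3 : ℕ) : ℤ) ^ kt * ((3 : ℕ) : ℤ) = (((3 : ℕ) : ℤ) ^ m * ((3 : ℕ) : ℤ)) * ((3 : ℕ) : ℤ) ^ (j + 1) := by
        rw [← hm]; ring
      rw [hsplit, mul_zsmul, hP']
      exact (mem_geomTorsion_iff W _ _).mp Q.2
    refine ⟨⟨P, hPmem⟩, Subtype.ext ?_⟩
    change ((red ⟨P, hPmem⟩ : geomTorsion W (((3 : ℕ) : ℤ) ^ m * ((3 : ℕ) : ℤ))) : geomPoints W) =
      (Q : geomPoints W)
    rw [hred]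
    exact hP'

/-- **A Selmer class of `E[3^{k̃+1}]` killed by `3^{j+1}` comes from a Selmer class of `E[3^{j+1}]`** (`j < k̃`,
surj(3)): exactness of `H¹(ℚ, E[3^j·3]) → H¹(ℚ, E[3^{k̃}·3]) → H¹(ℚ, E[3^m·3])` (`red_* y = 0` because
`incl′_* red_* y = 3^{j+1} y = 0` and `incl′_*` is injective) and the general-gap cartesian property of `𝓕_can`
place by place. [cite: MazurRubin2004, Lemma 4.1.1 (i) (p. 35) and Lemma 3.5.4] -/
theorem exists_mem_selmerGroup_map_torsionInclusion_eq [W.IsElliptic]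
    (hsurj : W.HasSurjectiveModNGaloisRep ((3 : ℕ) : ℤ)) {j kt : ℕ} (hjk : j < kt)
    {y : galoisCohomology (W.torsionGaloisModule (((3 : ℕ) : ℤ) ^ kt * ((3 : ℕ) : ℤ))) 1}
    (hy : y ∈ (propagatedSelmerStructure W 3 kt).selmerGroup) (hy0 : 3 ^ (j + 1) • y = 0) :
    ∃ x ∈ (propagatedSelmerStructure W 3 j).selmerGroup,
      galoisCohomology.map (W.torsionInclusion (Transport.pow_mul_dvd_pow_mul hjk.le)) 1 x = y := by
  haveI : Fact (Nat.Prime 3) := ⟨Nat.prime_three⟩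
  -- the reduction `red : E[3^{k̃}·3] → E[3^m·3]`, `m = k̃ - (j+1)`, `x ↦ 3^{j+1} x`
  set m : ℕ := kt - (j + 1) with hm_def
  have hm : m + (j + 1) = kt := by omega
  have hmk : m ≤ kt := by omega
  obtain ⟨red, hred'⟩ := exists_torsionReduction_three W m kt
  have hred : ∀ x : geomTorsion W (((3 : ℕ) : ℤ) ^ kt * ((3 : ℕ) : ℤ)),
      ((red x : geomTorsion W (((3 : ℕ) : ℤ) ^ m * ((3 : ℕ) : ℤ))) : geomPoints W) =
        (((3 : ℕ) : ℤ) ^ (j + 1)) • (x : geomPoints W) := fun x => by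
    rw [hred', show kt - m = j + 1 by omega]
  -- `red_* y = 0`: `incl′_* (red_* y) = 3^{j+1} y = 0` and `incl′_*` is injective (surj(3))
  have hΓ : ∀ P : geomTorsion W (((3 : ℕ) : ℤ) ^ kt * ((3 : ℕ) : ℤ)),
      (∀ σ : absoluteGaloisGroup ℚ, σ • P = P) → P = 0 :=
    fun P hP => Transport.geomTorsion_eq_zero_of_fixed_of_surj W hsurj kt P hP
  have hred0 : galoisCohomology.map red 1 y = 0 := by
    apply Transport.map_torsionInclusion_injective W hmk hΓ
    rw [Transport.map_torsionInclusion_map_red W hmk red hred' y, map_zero, show kt - m = j + 1 by omega, hy0]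
  -- exactness at `H¹(ℚ, E[3^{k̃}·3])`
  obtain ⟨x, hx⟩ : ∃ x : galoisCohomology (W.torsionGaloisModule (((3 : ℕ) : ℤ) ^ j * ((3 : ℕ) : ℤ))) 1,
      galoisCohomology.map (W.torsionInclusion (Transport.pow_mul_dvd_pow_mul hjk.le)) 1 x = y :=
    (isSES_torsionInclusion_red_of_le W hm hjk.le red hred).exists_map_one_eq_of_map_one_eq_zero y hred0
  refine ⟨x, ?_, hx⟩
  -- the Selmer condition of `x`, place by place, from the cartesian property
  rw [SelmerStructure.mem_selmerGroup_iff] at hy ⊢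
  intro v
  apply mem_propagatedSelmerStructure_of_localMap_torsionInclusion_mem_of_le W hjk.le v
  have h := hy v
  rw [← hx, CoreRankZero.localization_map_one_eq] at h
  exact h

/-- **(α) `#H¹_{𝓕_can}(ℚ, E[3^{k̃+1}])[3^{j+1}] = #H¹_{𝓕_can}(ℚ, E[3^{j+1}])`** for `j < k̃` under surj(3): `incl_*`
is an injection of `H¹_{𝓕_can}(ℚ, E[3^{j+1}])` onto the `3^{j+1}`-torsion of `H¹_{𝓕_can}(ℚ, E[3^{k̃+1}])`
(Mazur–Rubin Lemma 4.1.1 (i) for `𝓕_can` at an arbitrary gap). [cite: MazurRubin2004, Lemma 4.1.1 (i) (p. 35)] -/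
theorem natCard_torsion_selmerGroup_eq_of_lt [W.IsElliptic]
    (hsurj : W.HasSurjectiveModNGaloisRep ((3 : ℕ) : ℤ)) {j kt : ℕ} (hjk : j < kt) :
    Nat.card {y : (propagatedSelmerStructure W 3 kt).selmerGroup // 3 ^ (j + 1) • y = 0} =
      Nat.card (propagatedSelmerStructure W 3 j).selmerGroup := by
  haveI : Fact (Nat.Prime 3) := ⟨Nat.prime_three⟩
  set incl := W.torsionInclusion (Transport.pow_mul_dvd_pow_mul hjk.le) with hincl
  have hΓ : ∀ P : geomTorsion W (((3 : ℕ) : ℤ) ^ kt * ((3 : ℕ) : ℤ)),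
      (∀ σ : absoluteGaloisGroup ℚ, σ • P = P) → P = 0 :=
    fun P hP => Transport.geomTorsion_eq_zero_of_fixed_of_surj W hsurj kt P hP
  have hinj : Function.Injective (galoisCohomology.map incl 1) :=
    Transport.map_torsionInclusion_injective W hjk.le hΓ
  -- `incl_*` maps the Selmer group into the Selmer group (empty level of trivial data)
  let D : KolyvaginDatum (W.torsionGaloisModule (((3 : ℕ) : ℤ) ^ j * ((3 : ℕ) : ℤ))) :=
    ⟨∅, cyclotomicTransverse _, fun _ => 0⟩
  let D' : KolyvaginDatum (W.torsionGaloisModule (((3 : ℕ) : ℤ) ^ kt * ((3 : ℕ) : ℤ))) :=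
    ⟨∅, cyclotomicTransverse _, fun _ => 0⟩
  have hmem : ∀ x : (propagatedSelmerStructure W 3 j).selmerGroup,
      galoisCohomology.map incl 1 x.1 ∈ (propagatedSelmerStructure W 3 kt).selmerGroup := by
    intro x
    have hx : x.1 ∈ (D.atLevel (propagatedSelmerStructure W 3 j) ∅).selmerGroup := by simp
    simpa using Transport.map_torsionInclusion_mem_selmerGroup_atLevel W hjk.le D D' rfl rfl hx
  have hkill : ∀ x : (propagatedSelmerStructure W 3 j).selmerGroup,
      3 ^ (j + 1) • (⟨galoisCohomology.map incl 1 x.1, hmem x⟩ :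
        (propagatedSelmerStructure W 3 kt).selmerGroup) = 0 := fun x => Subtype.ext (by
    rw [AddSubgroupClass.coe_nsmul, ZeroMemClass.coe_zero, ← map_nsmul,
      Transport.pow_succ_nsmul_galoisCohomology W j, map_zero])
  let f : (propagatedSelmerStructure W 3 j).selmerGroup →
      {y : (propagatedSelmerStructure W 3 kt).selmerGroup // 3 ^ (j + 1) • y = 0} :=
    fun x => ⟨⟨galoisCohomology.map incl 1 x.1, hmem x⟩, hkill x⟩
  have hf : Function.Bijective f := by
    constructor
    · intro a b hab
      apply Subtype.ext
      exact hinj (congrArg (fun z => z.1.1) hab)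
    · intro y
      have hy0 : 3 ^ (j + 1) • y.1.1 = 0 := by
        have h := congrArg Subtype.val y.2
        rwa [AddSubgroupClass.coe_nsmul, ZeroMemClass.coe_zero] at h
      obtain ⟨x, hx, hxy⟩ := exists_mem_selmerGroup_map_torsionInclusion_eq W hsurj hjk y.1.2 hy0
      exact ⟨⟨x, hx⟩, Subtype.ext (Subtype.ext hxy)⟩
  exact (Nat.card_congr (Equiv.ofBijective f hf)).symm

end Summit.BirchSwinnertonDyer.BirchSwinnertonDyer.Theorems.KimAtThreeStubOfLiftable

end
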